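import Literature.GroupTheory.CombinatorialGroupTheory.FreeGroupResiduallyFinite
import Mathlib.GroupTheory.Index
import Mathlib.GroupTheory.GroupAction.Quotient
import Mathlib.Logic.Equiv.Fin.Basic
import Mathlib.SetTheory.Cardinal.Finite
import HarnessLib

/-!
# Finitely generated free groups are hopfian

Topic `Literature/GroupTheory/CombinatorialGroupTheory`; continues `FreeGroupResiduallyFinite.lean`.
A group is *hopfian* if every surjective endomorphism is an isomorphism.  We prove the classical
theorem of Nielsen (1921) / Magnus (1939) / Federer–Jónsson (1950), Lyndon–Schupp I Prop. 3.5: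
**every finitely generated free group is hopfian**, by Mal'cev's argument (Lyndon–Schupp IV
Thm. 4.10: finitely generated residually finite groups are hopfian):

* `FreeGroup.finite_setOf_index_eq` — a free group on a finite type has only finitely many
  subgroups of a given finite index `n ≠ 0` (each is the stabiliser of a point in a permutation
  representation on `Fin n`, and there are finitely many homomorphisms `F(α) → Sym(Fin n)`);
* `FreeGroup.injective_of_surjective` — a surjective endomorphism `φ` of `F(α)`, `α` finite, is
  injective: `H ↦ φ⁻¹ H` is an injection of the finite set of index-`n` subgroups into itself, hence
  a bijection, so every finite-index subgroup contains `ker φ`; by residual finiteness `ker φ = 1`;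
* `FreeGroup.injective_of_surjective_of_card_eq` — the two-alphabet form: a surjection
  `F(α) ↠ F(β)` between free groups on finite types of the same cardinality is injective.

## References

* R. C. Lyndon, P. E. Schupp, *Combinatorial Group Theory*, Springer 1977/2001, Ch. I Prop. 3.5,
  Ch. IV Thm. 4.10. [LyndonSchupp2001]
-/

namespace Literature.GroupTheory.CombinatorialGroupTheory

open Function

universe u v

variable {α : Type u}

/-- **The stabiliser description of a finite-index subgroup of a free group**: a subgroup of index
`n ≠ 0` of `F(α)` is the stabiliser of the point `0` for some permutation action of `F(α)` on
`Fin n` (namely the coset action, transported along a bijection `F(α) ⧸ H ≃ Fin n`).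
[cite: LyndonSchupp2001, Ch. IV Thm. 4.10] -/
theorem FreeGroup.exists_eq_comap_stabilizer (H : Subgroup (FreeGroup α)) {n : ℕ} (hn : H.index = n)
    (hn0 : 0 < n) :
    ∃ σ : α → Equiv.Perm (Fin n),
      H = (MulAction.stabilizer (Equiv.Perm (Fin n)) (⟨0, hn0⟩ : Fin n)).comap (FreeGroup.lift σ) := by
  classical
  haveI : H.FiniteIndex := ⟨by rw [hn]; exact Nat.pos_iff_ne_zero.1 hn0⟩
  -- a bijection `F(α) ⧸ H ≃ Fin n` carrying the base coset to `0`
  let e₀ : FreeGroup α ⧸ H ≃ Fin n :=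
    (Finite.equivFin (FreeGroup α ⧸ H)).trans (finCongr (by rw [← hn]; rfl))
  let e : FreeGroup α ⧸ H ≃ Fin n :=
    e₀.trans (Equiv.swap (e₀ ((1 : FreeGroup α) : FreeGroup α ⧸ H)) ⟨0, hn0⟩)
  have he : e ((1 : FreeGroup α) : FreeGroup α ⧸ H) = ⟨0, hn0⟩ := by
    simp [e]
  -- the coset action, transported to `Fin n`
  let ρ : FreeGroup α →* Equiv.Perm (Fin n) :=
    (Equiv.permCongrHom e).toMonoidHom.comp (MulAction.toPermHom (FreeGroup α) (FreeGroup α ⧸ H))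
  refine ⟨fun a => ρ (FreeGroup.of a), ?_⟩
  have hlift : FreeGroup.lift (fun a => ρ (FreeGroup.of a)) = ρ := by
    apply FreeGroup.ext_hom; intro a; rw [FreeGroup.lift_apply_of]
  rw [hlift]
  ext g
  rw [Subgroup.mem_comap, MulAction.mem_stabilizer_iff, ← MulAction.stabilizer_quotient H,
    MulAction.mem_stabilizer_iff]
  change _ ↔ e (g • e.symm ⟨0, hn0⟩) = ⟨0, hn0⟩
  rw [← he, Equiv.symm_apply_apply, e.apply_eq_iff_eq]

/-- **A free group of finite rank has finitely many subgroups of each finite index**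
(`n ≠ 0`; the index-`0`, i.e. infinite-index, subgroups are of course infinitely many).
[cite: LyndonSchupp2001, Ch. IV Thm. 4.10] -/
theorem FreeGroup.finite_setOf_index_eq [Finite α] {n : ℕ} (hn0 : n ≠ 0) :
    {H : Subgroup (FreeGroup α) | H.index = n}.Finite := by
  classical
  have hn : 0 < n := Nat.pos_iff_ne_zero.2 hn0
  let Φ : (α → Equiv.Perm (Fin n)) → Subgroup (FreeGroup α) := fun σ =>
    (MulAction.stabilizer (Equiv.Perm (Fin n)) (⟨0, hn⟩ : Fin n)).comap (FreeGroup.lift σ)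
  refine (Set.finite_range Φ).subset fun H hH => ?_
  obtain ⟨σ, hσ⟩ := FreeGroup.exists_eq_comap_stabilizer H hH hn
  exact ⟨σ, hσ.symm⟩

/-- **Finitely generated free groups are hopfian** (Nielsen, Magnus, Federer–Jónsson; Mal'cev's
proof): a surjective endomorphism of `F(α)`, `α` finite, is injective.
[cite: LyndonSchupp2001, Ch. I Prop. 3.5] -/
theorem FreeGroup.injective_of_surjective [Finite α] (φ : FreeGroup α →* FreeGroup α)
    (hφ : Surjective φ) : Injective φ := by
  classical
  rw [injective_iff_map_eq_one]
  intro g hg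
  by_contra hne
  obtain ⟨N, _, hNfi, hgN⟩ := exists_finiteIndex_normal_notMem g hne
  -- the finite set of subgroups of index `[F : N]`
  set n := N.index with hn
  have hfin : {H : Subgroup (FreeGroup α) | H.index = n}.Finite :=
    FreeGroup.finite_setOf_index_eq hNfi.index_ne_zero
  haveI : Finite {H : Subgroup (FreeGroup α) // H.index = n} := hfin.to_subtype
  -- pulling back along `φ` is an injection of this finite set into itself, hence a bijection
  let f : {H : Subgroup (FreeGroup α) // H.index = n} → {H : Subgroup (FreeGroup α) // H.index = n} :=
    fun H => ⟨H.1.comap φ, by rw [Subgroup.index_comap_of_surjective _ hφ]; exact H.2⟩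
  have hinj : Injective f := fun H H' h =>
    Subtype.ext (Subgroup.comap_injective hφ (congrArg Subtype.val h))
  obtain ⟨H', hH'⟩ := (Finite.injective_iff_surjective.1 hinj) ⟨N, rfl⟩
  have hN : N = H'.1.comap φ := (congrArg Subtype.val hH').symm
  exact hgN (by rw [hN, Subgroup.mem_comap, hg]; exact one_mem _)

/-- **Two-alphabet form**: a surjective homomorphism `F(α) ↠ F(β)` between free groups on finite
types of the same cardinality is injective (hence an isomorphism).
[cite: LyndonSchupp2001, Ch. I Prop. 3.5] -/
theorem FreeGroup.injective_of_surjective_of_card_eq {β : Type v} [Finite α] [Finite β]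
    (hcard : Nat.card α = Nat.card β) (φ : FreeGroup α →* FreeGroup β) (hφ : Surjective φ) :
    Injective φ := by
  classical
  -- `α ≃ β`, so `F(β) ≅ F(α)` and `φ` becomes a surjective endomorphism of `F(α)`
  let e : α ≃ β := (Finite.equivFin α).trans ((finCongr hcard).trans (Finite.equivFin β).symm)
  let E : FreeGroup β ≃* FreeGroup α := (FreeGroup.freeGroupCongr e).symm
  have h := FreeGroup.injective_of_surjective (E.toMonoidHom.comp φ) (E.surjective.comp hφ)
  exact fun x y hxy => h (by simp only [MonoidHom.coe_comp, MulEquiv.coe_toMonoidHom, comp_apply, hxy])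

/-- **Hopfian property along an isomorphism to a free group**: if `G ≃* F(α)` (`α` finite) — i.e.
`G` is free of finite rank `|α|` — then every surjection `G ↠ F(β)` onto a free group of the same
finite rank, `|β| = |α|`, is injective.  (The form used for one-relator quotients that happen to be
free, e.g. punctured surface groups.) [cite: LyndonSchupp2001, Ch. I Prop. 3.5] -/
theorem FreeGroup.injective_of_surjective_of_mulEquiv {G : Type*} [Group G] {β : Type v}
    [Finite α] [Finite β] (e : G ≃* FreeGroup α) (hcard : Nat.card α = Nat.card β)
    (φ : G →* FreeGroup β) (hφ : Surjective φ) : Injective φ := by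
  have h := FreeGroup.injective_of_surjective_of_card_eq hcard (φ.comp e.symm.toMonoidHom)
    (hφ.comp e.symm.surjective)
  intro x y hxy
  have := @h (e x) (e y) (by simp only [MonoidHom.coe_comp, MulEquiv.coe_toMonoidHom, comp_apply,
    MulEquiv.symm_apply_apply, hxy])
  exact e.injective this

end Literature.GroupTheory.CombinatorialGroupTheory
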